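import Mathlib
import Summits.NavierStokesRegularity.FluidComputer.AbcInertiaRegularity

/-!
# INERTIA-3L instantiation, Part 11: JORDAN CHAINS on the form domain are rapidly decaying — for `m = 1`
# the certified leader is ALGEBRAICALLY simple as an eigenvalue of the class-II operator on its form domain
# (instab3 g8, cell `ns-blowup`, 2026-08-27)

HONEST FRAMING (human ruling D-0035): nothing here is a claim about Navier–Stokes blow-up.
WHAT THIS IS NOT: not NS evidence. MODEL lane (forced-ABC linearisation, class II, coordinates of
`AbcClassIIDefs`); no certificate, number or census word moves.

`AbcInertiaEigenvalues.no_jordan_chain_of_count_one` excludes RAPIDLY DECAYING generalised eigenvectors.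
Here the regularity is supplied: if `L x = μ x`, `L y = μ y + x` with `x, y` in the FORM DOMAIN
`Σ(1+|O_i|²)|·|² < ∞` (`R ≥ 1`), then `y` (and `x`) are rapidly decaying (`rapid_of_formDomain_jordan`).
Trick: the pair `(x, y)` is an EIGENVECTOR of the doubled banded first-order system on `Idx × Fin 2`
(levels and weights copied, band `nbrIdx × {t} ∪ {(i, t+1)}`, the extra entry `−1` feeding `x` into the
`y`-equation is zeroth order), so the Literature bootstrap `FirstOrderBand.summable_weighted_of_eigen`
applies verbatim. Hence **`no_formDomain_jordan_chain_of_count_one`**: given the INERTIA-3L count `≤ 1` of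
a cell `(R, a, 1)`, an eigenvalue `μ` with `Re μ ≥ a` admits no Jordan chain of length 2 in the form domain.

Mathlib + `AbcInertiaRegularity`; no new definitions; std axioms. [folklore]
-/

noncomputable section

open scoped BigOperators ComplexConjugate InnerProductSpace lp
open Finset

namespace Summit.NavierStokesRegularity.FluidComputer.AbcInertia

open Literature.Analysis.FunctionSpaces Literature.Analysis.FunctionSpaces.Torus
open Literature.Analysis.FluidPDE
open Summit.NavierStokesRegularity.FluidComputer.AbcClassII

/-- Summability on `Idx × Fin 2` from summability of the two slices. -/
theorem summable_prod_fin_two {h : Idx × Fin 2 → ℝ} (h0 : ∀ p, 0 ≤ h p)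
    (hs0 : Summable fun i : Idx => h (i, 0)) (hs1 : Summable fun i : Idx => h (i, 1)) : Summable h := by
  classical
  refine summable_of_sum_le h0 (c := ∑' i, h (i, 0) + ∑' i, h (i, 1)) fun F => ?_
  have hsub : F ⊆ (F.image Prod.fst) ×ˢ (Finset.univ : Finset (Fin 2)) := by
    intro p hp
    exact Finset.mem_product.mpr ⟨Finset.mem_image_of_mem _ hp, Finset.mem_univ _⟩
  calc ∑ p ∈ F, h p ≤ ∑ p ∈ (F.image Prod.fst) ×ˢ (Finset.univ : Finset (Fin 2)), h p :=
        Finset.sum_le_sum_of_subset_of_nonneg hsub fun p _ _ => h0 p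
    _ = ∑ i ∈ F.image Prod.fst, (h (i, 0) + h (i, 1)) := by
        rw [Finset.sum_product]
        refine Finset.sum_congr rfl fun i _ => ?_
        rw [Fin.sum_univ_two]
    _ = ∑ i ∈ F.image Prod.fst, h (i, 0) + ∑ i ∈ F.image Prod.fst, h (i, 1) := Finset.sum_add_distrib
    _ ≤ ∑' i, h (i, 0) + ∑' i, h (i, 1) :=
        add_le_add (hs0.sum_le_tsum _ fun i _ => h0 _) (hs1.sum_le_tsum _ fun i _ => h0 _)

/-- **A form-domain Jordan chain of length 2 is rapidly decaying** (`R ≥ 1`): `L x = μ x`, `L y = μ y + x`,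
`x, y` in the form domain ⇒ `y` rapidly decaying. -/
theorem rapid_of_formDomain_jordan {R : ℝ} (hR : 1 ≤ R) (μ : ℂ) {x y : Idx → ℂ}
    (hx1 : Summable fun i : Idx => (1 + onormSq i.1) * ‖x i‖ ^ 2)
    (hy1 : Summable fun i : Idx => (1 + onormSq i.1) * ‖y i‖ ^ 2)
    (hx : ∀ i : Idx, ((-(onormSq i.1 / R) : ℝ) : ℂ) * x i + ∑ j ∈ nbrIdx i, ((amat i j : ℝ) : ℂ) * x j =
      μ * x i)
    (hy : ∀ i : Idx, ((-(onormSq i.1 / R) : ℝ) : ℂ) * y i + ∑ j ∈ nbrIdx i, ((amat i j : ℝ) : ℂ) * y j =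
      μ * y i + x i) (s : ℕ) :
    Summable fun i : Idx => (1 + onormSq i.1) ^ s * ‖y i‖ ^ 2 := by
  classical
  have hR0 : 0 < R := by linarith
  have fin2_add_one_ne : ∀ t : Fin 2, t + 1 ≠ t := by decide
  have fin2_add_one_add_one : ∀ t : Fin 2, t + 1 + 1 = t := by decide
  -- the doubled coefficient vector
  set c : Idx × Fin 2 → ℂ := fun p => if p.2 = 0 then x p.1 else y p.1 with hc
  have hc0 : ∀ i, c (i, 0) = x i := fun i => by simp [hc]
  have hc1 : ∀ i, c (i, 1) = y i := fun i => by simp [hc]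
  have hcs : Summable fun p : Idx × Fin 2 => ‖c p‖ ^ 2 :=
    summable_prod_fin_two (fun p => sq_nonneg _)
      ((summable_norm_sq_of_weighted hx1).congr fun i => by rw [hc0])
      ((summable_norm_sq_of_weighted hy1).congr fun i => by rw [hc1])
  have hmem : Memℓp c 2 := by
    refine memℓp_gen ?_
    refine hcs.congr fun p => ?_
    rw [ENNReal.toReal_ofNat, Real.rpow_two]
  set f : ℓ²(Idx × Fin 2, ℂ) := ⟨c, hmem⟩ with hf
  set b : HilbertBasis (Idx × Fin 2) ℂ ℓ²(Idx × Fin 2, ℂ) :=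
    HilbertBasis.ofRepr (LinearIsometryEquiv.refl ℂ ℓ²(Idx × Fin 2, ℂ)) with hb
  have hcoef : ∀ p, ⟪b p, f⟫_ℂ = c p := by
    intro p; rw [← b.repr_apply_apply]; rfl
  -- weights, levels, band, matrix of the doubled system
  set w : Idx × Fin 2 → ℝ := fun p => Real.sqrt (1 + onormSq p.1.1 / R) with hw
  set ℓ : Idx × Fin 2 → ℝ := fun p => -(onormSq p.1.1 / R) with hℓ
  set nb : Idx × Fin 2 → Finset (Idx × Fin 2) := fun p =>
    (nbrIdx p.1).image (fun j => (j, p.2)) ∪ {(p.1, p.2 + 1)} with hnb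
  set A : Idx × Fin 2 → Idx × Fin 2 → ℂ := fun p q =>
    if q.2 = p.2 then ((amat p.1 q.1 : ℝ) : ℂ) else (if p.2 = 1 ∧ q.1 = p.1 then -1 else 0) with hA
  have hq : ∀ p : Idx × Fin 2, 0 ≤ onormSq p.1.1 / R := fun p => div_nonneg (onormSq_nonneg _) hR0.le
  have hw0 : ∀ p, 0 ≤ w p := fun p => Real.sqrt_nonneg _
  have hwsq : ∀ p, w p ^ 2 = 1 + onormSq p.1.1 / R := fun p => Real.sq_sqrt (by linarith [hq p])
  have hw1 : ∀ p, 1 ≤ w p := by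
    intro p; rw [hw]
    calc (1 : ℝ) = Real.sqrt 1 := Real.sqrt_one.symm
      _ ≤ Real.sqrt (1 + onormSq p.1.1 / R) := Real.sqrt_le_sqrt (by linarith [hq p])
  have hwℓ : ∀ p, w p ^ 2 ≤ 1 + |ℓ p| := by
    intro p; rw [hwsq, hℓ]; simp only [abs_neg, abs_of_nonneg (hq p)]; exact le_rfl
  have hmem_nb : ∀ p q : Idx × Fin 2, q ∈ nb p ↔ (q.2 = p.2 ∧ q.1 ∈ nbrIdx p.1) ∨ q = (p.1, p.2 + 1) := by
    intro p q
    simp only [hnb, Finset.mem_union, Finset.mem_image, Finset.mem_singleton]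
    constructor
    · rintro (⟨j, hj, rfl⟩ | h)
      · exact Or.inl ⟨rfl, hj⟩
      · exact Or.inr h
    · rintro (⟨h2, h1⟩ | h)
      · exact Or.inl ⟨q.1, h1, by rw [← h2]⟩
      · exact Or.inr h
  have hsymm : ∀ p q, q ∈ nb p ↔ p ∈ nb q := by
    intro p q
    rw [hmem_nb, hmem_nb]
    constructor
    · rintro (⟨h2, h1⟩ | h)
      · exact Or.inl ⟨h2.symm, (mem_nbrIdx_comm p.1 q.1).mp h1⟩
      · right; rw [h]; ext <;> simp [fin2_add_one_add_one]
    · rintro (⟨h2, h1⟩ | h)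
      · exact Or.inl ⟨h2.symm, (mem_nbrIdx_comm q.1 p.1).mp h1⟩
      · right; rw [h]; ext <;> simp [fin2_add_one_add_one]
  have hcard : ∀ p, (nb p).card ≤ 288 * 288 + 1 := by
    intro p
    refine (Finset.card_union_le _ _).trans ?_
    rw [Finset.card_singleton]
    exact Nat.add_le_add_right (Finset.card_image_le.trans (card_nbrIdx_le p.1)) 1
  have hgrowth : ∀ p q, q ∈ nb p → ‖A p q‖ ≤ (2592 * Real.sqrt R + 1) * w q := by
    intro p q _
    by_cases h2 : q.2 = p.2
    · simp only [hA, if_pos h2, Complex.norm_real, Real.norm_eq_abs]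
      refine (abs_amat_le p.1 q.1).trans ?_
      have h1 : Real.sqrt (1 + onormSq q.1.1) ≤ Real.sqrt R * w q := by
        rw [hw, ← Real.sqrt_mul hR0.le]
        refine Real.sqrt_le_sqrt ?_
        have := onormSq_nonneg q.1.1
        have e : R * (1 + onormSq q.1.1 / R) = R + onormSq q.1.1 := by field_simp
        rw [e]; linarith
      nlinarith [Real.sqrt_nonneg (1 + onormSq q.1.1), hw1 q, Real.sqrt_nonneg R]
    · simp only [hA, if_neg h2]
      have : ‖(if p.2 = 1 ∧ q.1 = p.1 then (-1 : ℂ) else 0)‖ ≤ 1 := by split_ifs <;> simp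
      nlinarith [hw1 q, Real.sqrt_nonneg R]
  have hL : ∀ p q, q ∈ nb p → w p ≤ Real.sqrt (2 * (1 + R⁻¹)) * w q := by
    intro p q hpq
    rcases (hmem_nb p q).mp hpq with ⟨_, h1⟩ | h
    · rw [hw, ← Real.sqrt_mul (by positivity)]
      exact Real.sqrt_le_sqrt (one_add_onormSq_le_of_mem_nbrIdx hR0 h1)
    · have e : w q = w p := by rw [h]
      rw [e]
      have hL1 : 1 ≤ Real.sqrt (2 * (1 + R⁻¹)) := by
        rw [← Real.sqrt_one]; exact Real.sqrt_le_sqrt (by have := inv_nonneg.mpr hR0.le; linarith)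
      nlinarith [hw0 p]
  -- the band sums of the doubled system
  have hsum_nb : ∀ (p : Idx × Fin 2) (g : Idx × Fin 2 → ℂ),
      ∑ q ∈ nb p, A p q * g q = ∑ j ∈ nbrIdx p.1, ((amat p.1 j : ℝ) : ℂ) * g (j, p.2) +
        A p (p.1, p.2 + 1) * g (p.1, p.2 + 1) := by
    intro p g
    have hdisj : Disjoint ((nbrIdx p.1).image (fun j => (j, p.2))) {(p.1, p.2 + 1)} := by
      rw [Finset.disjoint_singleton_right, Finset.mem_image]
      rintro ⟨j, _, hj⟩
      exact fin2_add_one_ne p.2 (congrArg Prod.snd hj).symm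
    rw [hnb, Finset.sum_union hdisj, Finset.sum_singleton,
      Finset.sum_image fun j _ j' _ h => congrArg Prod.fst h]
    congr 1
    refine Finset.sum_congr rfl fun j _ => ?_
    simp only [hA, if_pos rfl]
  -- the entries of the doubled matrix that are used
  have hA00 : ∀ i j : Idx, A (i, 0) (j, 0) = ((amat i j : ℝ) : ℂ) := fun i j => by simp [hA]
  have hA11 : ∀ i j : Idx, A (i, 1) (j, 1) = ((amat i j : ℝ) : ℂ) := fun i j => by simp [hA]
  have hA01 : ∀ i : Idx, A (i, 0) (i, 1) = 0 := fun i => by simp [hA]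
  have hA10 : ∀ i : Idx, A (i, 1) (i, 0) = -1 := fun i => by simp [hA]
  have e01 : ((0 : Fin 2) + 1) = 1 := by decide
  have e10 : ((1 : Fin 2) + 1) = 0 := by decide
  -- the eigen-equation of the doubled system, slice by slice
  have heig0 : ∀ i : Idx, (ℓ (i, 0) : ℂ) * ⟪b (i, 0), f⟫_ℂ + ∑ q ∈ nb (i, 0), A (i, 0) q * ⟪b q, f⟫_ℂ =
      μ * ⟪b (i, 0), f⟫_ℂ := by
    intro i
    simp only [hcoef]
    rw [hsum_nb (i, 0) c]
    dsimp only
    rw [e01, hA01, hc0, hc1, zero_mul, add_zero]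
    simp only [hc0]
    exact hx i
  have heig1 : ∀ i : Idx, (ℓ (i, 1) : ℂ) * ⟪b (i, 1), f⟫_ℂ + ∑ q ∈ nb (i, 1), A (i, 1) q * ⟪b q, f⟫_ℂ =
      μ * ⟪b (i, 1), f⟫_ℂ := by
    intro i
    simp only [hcoef]
    rw [hsum_nb (i, 1) c]
    dsimp only
    rw [e10, hA10, hc0, hc1]
    simp only [hc1]
    have := hy i
    linear_combination this
  have heig : ∀ p : Idx × Fin 2, (ℓ p : ℂ) * ⟪b p, f⟫_ℂ + ∑ q ∈ nb p, A p q * ⟪b q, f⟫_ℂ = μ * ⟪b p, f⟫_ℂ := by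
    rintro ⟨i, t⟩
    fin_cases t
    · exact heig0 i
    · exact heig1 i
  -- form-level energy of the pair
  have h1 : Summable fun p : Idx × Fin 2 => w p ^ 2 * ‖⟪b p, f⟫_ℂ‖ ^ 2 := by
    have hle : ∀ (g : Idx → ℂ) (i : Idx), (1 + onormSq i.1 / R) * ‖g i‖ ^ 2 ≤ (1 + onormSq i.1) * ‖g i‖ ^ 2 := by
      intro g i
      have : onormSq i.1 / R ≤ onormSq i.1 := div_le_self (onormSq_nonneg i.1) hR
      exact mul_le_mul_of_nonneg_right (by linarith) (sq_nonneg _)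
    refine summable_prod_fin_two (fun p => mul_nonneg (sq_nonneg _) (sq_nonneg _)) ?_ ?_
    · refine Summable.of_nonneg_of_le (fun i => mul_nonneg (sq_nonneg _) (sq_nonneg _)) (fun i => ?_) hx1
      rw [hcoef, hc0, hwsq]; exact hle x i
    · refine Summable.of_nonneg_of_le (fun i => mul_nonneg (sq_nonneg _) (sq_nonneg _)) (fun i => ?_) hy1
      rw [hcoef, hc1, hwsq]; exact hle y i
  -- the bootstrap
  have hboot := Literature.Analysis.OperatorTheory.FirstOrderBand.summable_weighted_of_eigen (e := b)
    (w := w) (ℓ := ℓ) (nbr := nb) (a := A) (K := 2592 * Real.sqrt R + 1) (L := Real.sqrt (2 * (1 + R⁻¹)))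
    (W := 288 * 288 + 1) (f := f) (lam := μ)
    hw0 hwℓ (by positivity) hgrowth hsymm hcard (Real.sqrt_nonneg _) hL heig h1 s
  -- restrict to the `y`-slice and compare weights
  have hslice : Summable fun i : Idx => w (i, 1) ^ (2 * s) * ‖⟪b (i, 1), f⟫_ℂ‖ ^ 2 :=
    hboot.comp_injective (f := fun p : Idx × Fin 2 => w p ^ (2 * s) * ‖⟪b p, f⟫_ℂ‖ ^ 2)
      (fun i j h => congrArg Prod.fst h)
  refine Summable.of_nonneg_of_le (fun i => mul_nonneg (pow_nonneg (by linarith [onormSq_nonneg i.1]) _)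
    (sq_nonneg _)) (fun i => ?_) (hslice.mul_left (R ^ s))
  rw [hcoef, hc1, pow_mul, hwsq, ← mul_assoc, ← mul_pow]
  refine mul_le_mul_of_nonneg_right (pow_le_pow_left₀ (by linarith [onormSq_nonneg i.1]) ?_ s) (sq_nonneg _)
  have e : R * (1 + onormSq i.1 / R) = R + onormSq i.1 := by field_simp
  change 1 + onormSq i.1 ≤ R * (1 + onormSq i.1 / R)
  rw [e]; linarith

/-- **For `m = 1`: no Jordan chain in the FORM DOMAIN.** Given the count `≤ 1` of a cell `(R, a, 1)`
(`R ≥ 1`), an eigenvalue `μ` with `Re μ ≥ a` and form-domain eigenvector `x ≠ 0` admits no form-domain `y`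
with `L y = μ y + x` — the leader is algebraically simple as an eigenvalue of the class-II operator on its
form domain. -/
theorem no_formDomain_jordan_chain_of_count_one {R a : ℝ} (hR : 1 ≤ R)
    (hcount1 : ∀ (W : Submodule ℂ (Idx → ℂ)), FiniteDimensional ℂ W →
      (∀ x ∈ W, ∀ s : ℕ, Summable fun i : Idx => (1 + onormSq i.1) ^ s * ‖x i‖ ^ 2) →
      (∀ x ∈ W, (fun i : Idx => ((-(onormSq i.1 / R) : ℝ) : ℂ) * x i +
        ∑ j ∈ nbrIdx i, ((amat i j : ℝ) : ℂ) * x j) ∈ W) →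
      (∀ (μ : ℂ) (x : Idx → ℂ), x ∈ W → x ≠ 0 →
        (∀ i : Idx, ((-(onormSq i.1 / R) : ℝ) : ℂ) * x i + ∑ j ∈ nbrIdx i, ((amat i j : ℝ) : ℂ) * x j = μ * x i) →
        a ≤ μ.re) →
      Module.finrank ℂ W ≤ 1)
    (μ : ℂ) (hμ : a ≤ μ.re) (x y : Idx → ℂ)
    (hx1 : Summable fun i : Idx => (1 + onormSq i.1) * ‖x i‖ ^ 2)
    (hy1 : Summable fun i : Idx => (1 + onormSq i.1) * ‖y i‖ ^ 2) (hx0 : x ≠ 0)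
    (hx : ∀ i : Idx, ((-(onormSq i.1 / R) : ℝ) : ℂ) * x i + ∑ j ∈ nbrIdx i, ((amat i j : ℝ) : ℂ) * x j = μ * x i)
    (hy : ∀ i : Idx, ((-(onormSq i.1 / R) : ℝ) : ℂ) * y i + ∑ j ∈ nbrIdx i, ((amat i j : ℝ) : ℂ) * y j =
      μ * y i + x i) : False :=
  no_jordan_chain_of_count_one hcount1 μ hμ x y (rapid_of_formDomain_eigen hR μ hx1 hx)
    (rapid_of_formDomain_jordan hR μ hx1 hy1 hx hy) hx0 hx hy

end Summit.NavierStokesRegularity.FluidComputer.AbcInertia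

end
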